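import Summits.AnomalousDissipation.AnomalousDissipation.Theorems.SawtoothPulseCascadeK2CombPreserved
import Literature.Analysis.FunctionSpaces.TorusFourierSynthesis
import Literature.Analysis.FluidPDE.ShearCascadeDrifts
import Mathlib.MeasureTheory.Integral.IntervalIntegral.FundThmCalculus

/-!
# Fourier coefficients of forced heat profiles: variation of constants, bounds, and uniqueness
(route `AnomalousDissipation/SawtoothPulseCascade`; helper for the crux ApproxSol58 =
stmt-AnomalousDissipation-19688, registered stub `stub_responseL2` / S1 `stub_responseL2Envelope`:
the realignment pipeline, heat-flow side)

On each half-slot the forced linearised response of the cascade created during the slot is a parallel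
FORCED HEAT PROFILE `h` (`K2Classical.exists_forcedParallel_H/_V`, p459493):
`∂ₜ|_{[a,b]} h = ν ∂²_y h + r(t) V(y)` with `V = ν U_j''` and `r = rateH_j` (resp. `rateV_j`).  Reading
`h(t, ·)` through its coordinate function on `𝕋¹` (g4's glue `mFourierCoeff_coordFun_one`,
`isSmoothSpaceTimeOn_coordFun_one`, `laplacian_coordFun_one`), this file proves:

* §1 the coefficient ODE with viscosity `ν` and a source, `c' = −4π²ν|k|² c + 𝓕(f(t))(k)` on `𝕋^d`,
  and its integrated form (variation of constants);
* §2 for profiles with a separated source `r(t) V(y)`: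
  `𝓕(h(t))(m) = e^{−4π²νm²(t−a)} 𝓕(h(a))(m) + 𝓕(V)(m) ∫ₐᵗ r(s) e^{−4π²νm²(t−s)} ds`, hence from zero
  datum `‖𝓕(h(t))(m)‖ ≤ ‖𝓕(V)(m)‖ ∫ₐᵗ |r|` (`ν ≥ 0`);
* §3 `𝓕(U'')(m) = −4π²m² 𝓕(U)(m)`; two smooth `1`-periodic profiles with the same coefficients are
  equal; `|g(y)| ≤ Σ_m ‖𝓕(g)(m)‖`-type pointwise bounds from a summable coefficient majorant.
-/

set_option linter.dupNamespace false

noncomputable section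

namespace Summit.AnomalousDissipation.AnomalousDissipation.Theorems.SawtoothPulseCascade.ApproxResponse

open Set MeasureTheory Complex UnitAddTorus
open scoped ContDiff
open Literature.Analysis Literature.Analysis.FunctionSpaces Literature.Analysis.FluidPDE
open Summit.AnomalousDissipation.AnomalousDissipation.Theorems.SawtoothPulseCascade.K2Classical

/-! ## §1 The coefficient ODE of a forced heat solution on `𝕋^d` with viscosity `ν` -/

section Torus

variable {d : Type*} [Fintype d] [DecidableEq d]

/-- **Coefficient ODE**: if `∂ₜθ = νΔθ + f` on `[a, b] × 𝕋^d` (`a < b`, `θ`, `f` jointly smooth), then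
`c(t) = 𝓕(θ(t))(k)` satisfies `c' = −4π²ν|k|² c + 𝓕(f(t))(k)` within `[a, b]`. -/
theorem hasDerivWithinAt_mFourierCoeff_heatForced_visc {a b ν : ℝ} (hab : a < b)
    {f θ : ℝ → UnitAddTorus d → ℝ} (hf : Torus.IsSmoothSpaceTimeOn (Icc a b) f)
    (hθ : Torus.IsSmoothSpaceTimeOn (Icc a b) θ)
    (heq : ∀ t ∈ Icc a b, ∀ x, Torus.timeDerivWithin (Icc a b) θ t x = ν * Torus.laplacian (θ t) x + f t x)
    (k : d → ℤ) {t : ℝ} (ht : t ∈ Icc a b) :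
    HasDerivWithinAt (fun s => mFourierCoeff (fun y => (θ s y : ℂ)) k)
      (-((4 * Real.pi ^ 2 * ν * Torus.freqNormSq k : ℝ) : ℂ) * mFourierCoeff (fun y => (θ t y : ℂ)) k +
        mFourierCoeff (fun y => (f t y : ℂ)) k) (Icc a b) t := by
  have hU : UniqueDiffOn ℝ (Icc a b) := uniqueDiffOn_Icc hab
  have hθC : Torus.IsSmoothSpaceTimeOn (Icc a b) (fun s y => (θ s y : ℂ)) := hθ.ofReal
  have h := ScalarFourier.hasDerivWithinAt_mFourierCoeff hθC (convex_Icc a b) hU ht k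
  have hθt : Torus.IsSmooth (θ t) := hθ.isSmooth_slice ht
  have hft : Torus.IsSmooth (f t) := hf.isSmooth_slice ht
  have hder : Torus.timeDerivWithin (Icc a b) (fun s y => (θ s y : ℂ)) t =
      (fun y => (ν : ℂ) • Torus.laplacian (fun y => (θ t y : ℂ)) y) + fun y => ((f t y : ℝ) : ℂ) := by
    funext y
    rw [Torus.timeDerivWithin_ofReal hθ hU ht y, heq t ht y, Complex.ofReal_add, Complex.ofReal_mul]
    simp only [Pi.add_apply, smul_eq_mul, Torus.laplacian_ofReal hθt y]
  have hi1 : Integrable (fun y => (ν : ℂ) • Torus.laplacian (fun y => (θ t y : ℂ)) y) volume := by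
    have hc : Continuous (Torus.laplacian (fun y => ((θ t y : ℝ) : ℂ))) :=
      (hθt.comp_clm Complex.ofRealCLM).laplacian.continuous
    exact (hc.const_smul (ν : ℂ)).integrable_unitAddTorus
  have hi2 : Integrable (fun y => ((f t y : ℝ) : ℂ)) volume :=
    (Complex.continuous_ofReal.comp hft.continuous).integrable_unitAddTorus
  rw [hder, Torus.mFourierCoeff_add hi1 hi2,
    show (fun y => (ν : ℂ) • Torus.laplacian (fun y => (θ t y : ℂ)) y) =
      (ν : ℂ) • Torus.laplacian (fun y => (θ t y : ℂ)) from rfl,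
    Torus.mFourierCoeff_const_smul,
    Torus.mFourierCoeff_laplacian (g := fun y => ((θ t y : ℝ) : ℂ)) (hθt.comp_clm Complex.ofRealCLM),
    smul_neg, smul_smul, smul_eq_mul] at h
  convert h using 1
  push_cast
  ring

/-- **Variation of constants.** Under the hypotheses of `hasDerivWithinAt_mFourierCoeff_heatForced_visc`,
with `λ = 4π²ν|k|²`: `e^{λ(t−a)} 𝓕(θ(t))(k) − 𝓕(θ(a))(k) = ∫ₐᵗ e^{λ(s−a)} 𝓕(f(s))(k) ds` for
`t ∈ [a, b]`. -/
theorem exp_mul_mFourierCoeff_heatForced_eq {a b ν : ℝ} (hab : a < b)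
    {f θ : ℝ → UnitAddTorus d → ℝ} (hf : Torus.IsSmoothSpaceTimeOn (Icc a b) f)
    (hθ : Torus.IsSmoothSpaceTimeOn (Icc a b) θ)
    (heq : ∀ t ∈ Icc a b, ∀ x, Torus.timeDerivWithin (Icc a b) θ t x = ν * Torus.laplacian (θ t) x + f t x)
    (k : d → ℤ) {t : ℝ} (ht : t ∈ Icc a b) :
    ((Real.exp ((4 * Real.pi ^ 2 * ν * Torus.freqNormSq k) * (t - a)) : ℝ) : ℂ) *
          mFourierCoeff (fun y => (θ t y : ℂ)) k - mFourierCoeff (fun y => (θ a y : ℂ)) k =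
      ∫ s in a..t, ((Real.exp ((4 * Real.pi ^ 2 * ν * Torus.freqNormSq k) * (s - a)) : ℝ) : ℂ) *
        mFourierCoeff (fun y => (f s y : ℂ)) k := by
  set lam : ℝ := 4 * Real.pi ^ 2 * ν * Torus.freqNormSq k with hlam
  set c : ℝ → ℂ := fun s => mFourierCoeff (fun y => (θ s y : ℂ)) k with hc
  set F : ℝ → ℂ := fun s => mFourierCoeff (fun y => (f s y : ℂ)) k with hF
  set g : ℝ → ℂ := fun s => ((Real.exp (lam * (s - a)) : ℝ) : ℂ) * c s with hg
  have hU : UniqueDiffOn ℝ (Icc a b) := uniqueDiffOn_Icc hab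
  -- `g' = e^{λ(s-a)} F(s)` within `[a, b]`
  have hgd : ∀ s ∈ Icc a b, HasDerivWithinAt g (((Real.exp (lam * (s - a)) : ℝ) : ℂ) * F s) (Icc a b) s := by
    intro s hs
    have h1 : HasDerivWithinAt (fun r => ((Real.exp (lam * (r - a)) : ℝ) : ℂ))
        (((lam * Real.exp (lam * (s - a)) : ℝ) : ℂ)) (Icc a b) s := by
      have he : HasDerivAt (fun r => Real.exp (lam * (r - a))) (Real.exp (lam * (s - a)) * (lam * 1)) s := by
        have := ((hasDerivAt_id s).sub_const a).const_mul lam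
        exact (Real.hasDerivAt_exp _).comp s this
      have he' := he.ofReal_comp
      rw [show Real.exp (lam * (s - a)) * (lam * 1) = lam * Real.exp (lam * (s - a)) by ring] at he'
      exact he'.hasDerivWithinAt
    have h2 := hasDerivWithinAt_mFourierCoeff_heatForced_visc hab hf hθ heq k hs
    have h12 := h1.mul h2
    refine h12.congr_deriv ?_
    simp only [hF, hlam]
    push_cast
    ring
  -- `F` is continuous on `[a, b]` (it is differentiable there)
  have hFc : ContinuousOn (fun s => ((Real.exp (lam * (s - a)) : ℝ) : ℂ) * F s) (Icc a b) := by
    have hFd : ∀ s ∈ Icc a b, ContinuousWithinAt F (Icc a b) s := fun s hs =>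
      (ScalarFourier.hasDerivWithinAt_mFourierCoeff hf.ofReal (convex_Icc a b) hU hs k).continuousWithinAt
    exact ((Complex.continuous_ofReal.comp (Real.continuous_exp.comp
      (continuous_const.mul (continuous_id.sub continuous_const)))).continuousOn).mul hFd
  -- FTC on `[a, t]`
  have hta : a ≤ t := ht.1
  have hsub : Icc a t ⊆ Icc a b := Icc_subset_Icc le_rfl ht.2
  have hgc : ContinuousOn g (Icc a t) := fun s hs => ((hgd s (hsub hs)).continuousWithinAt).mono hsub
  have hderiv : ∀ s ∈ Ioo a t, HasDerivWithinAt g (((Real.exp (lam * (s - a)) : ℝ) : ℂ) * F s) (Ioi s) s := by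
    intro s hs
    have hs' : s ∈ Icc a b := hsub (Ioo_subset_Icc_self hs)
    have hnhds : Icc a b ∈ nhds s := Icc_mem_nhds hs.1 (hs.2.trans_le ht.2)
    exact ((hgd s hs').hasDerivAt hnhds).hasDerivWithinAt
  have hint : IntervalIntegrable (fun s => ((Real.exp (lam * (s - a)) : ℝ) : ℂ) * F s) volume a t :=
    ((hFc.mono hsub).intervalIntegrable_of_Icc hta)
  have hftc := intervalIntegral.integral_eq_sub_of_hasDeriv_right_of_le hta hgc hderiv hint
  rw [hftc]
  simp only [hg, hc, sub_self, mul_zero, Real.exp_zero, Complex.ofReal_one, one_mul]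

end Torus


/-! ## §2 Forced heat PROFILES (`1`-periodic, on `ℝ`) read on `𝕋¹` -/

/-- Every frequency of `𝕋¹` is `m e₀`. -/
theorem fin_one_freq_eq (k : Fin 1 → ℤ) : k = Pi.single 0 (k 0) := by
  funext i
  fin_cases i
  simp

/-- `freqNormSq (m e₀) = m²` on `𝕋¹`. -/
theorem freqNormSq_single_zero (m : ℤ) : Torus.freqNormSq (Pi.single (0 : Fin 1) m) = (m : ℝ) ^ 2 := by
  simp [Torus.freqNormSq]

/-- A source profile `(s, y) ↦ r(s) V(y)` with smooth factors is jointly smooth. -/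
theorem contDiffOn_uncurry_mul_sep {r V : ℝ → ℝ} (hr : ContDiff ℝ ∞ r) (hV : ContDiff ℝ ∞ V) (S : Set ℝ) :
    ContDiffOn ℝ ∞ (Function.uncurry fun s y => r s * V y) (S ×ˢ univ) :=
  ((hr.comp contDiff_fst).mul (hV.comp contDiff_snd)).contDiffOn

/-- **Variation of constants for a forced heat profile with separated source.** Let `h` be jointly
smooth on `[a, b] × ℝ`, `1`-periodic in space, with `∂ₜ|_{[a,b]} h = ν ∂²_y h + r(t) V(y)` pointwise
(`r`, `V` smooth, `V` `1`-periodic, `a < b`).  Then for every `m ∈ ℤ` and `t ∈ [a, b]`, with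
`λ = 4π²νm²`: `e^{λ(t−a)} 𝓕(h(t))(m) − 𝓕(h(a))(m) = (∫ₐᵗ e^{λ(s−a)} r(s) ds) · 𝓕(V)(m)`. -/
theorem fourierCoeff_heatProfile_forced {a b ν : ℝ} (hab : a < b) {h : ℝ → ℝ → ℝ}
    (hh : ContDiffOn ℝ ∞ (Function.uncurry h) (Icc a b ×ˢ univ))
    (hper : ∀ t ∈ Icc a b, Function.Periodic (h t) 1)
    {r V : ℝ → ℝ} (hr : ContDiff ℝ ∞ r) (hV : ContDiff ℝ ∞ V) (hVper : Function.Periodic V 1)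
    (heat : ∀ t ∈ Icc a b, ∀ y,
      derivWithin (fun τ => h τ y) (Icc a b) t = ν * deriv (deriv (h t)) y + r t * V y)
    (m : ℤ) {t : ℝ} (ht : t ∈ Icc a b) :
    ((Real.exp ((4 * Real.pi ^ 2 * ν * (m : ℝ) ^ 2) * (t - a)) : ℝ) : ℂ) *
          fourierCoeff (AddCircle.liftIco 1 0 fun y => (h t y : ℂ)) m -
        fourierCoeff (AddCircle.liftIco 1 0 fun y => (h a y : ℂ)) m =
      ((∫ s in a..t, Real.exp ((4 * Real.pi ^ 2 * ν * (m : ℝ) ^ 2) * (s - a)) * r s : ℝ) : ℂ) *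
        fourierCoeff (AddCircle.liftIco 1 0 fun y => (V y : ℂ)) m := by
  -- the coordinate fields on `𝕋¹`
  set θ : ℝ → UnitAddTorus (Fin 1) → ℝ := fun s z => h s (Torus.repr z 0) with hθ_def
  set f : ℝ → UnitAddTorus (Fin 1) → ℝ := fun s z => r s * V (Torus.repr z 0) with hf_def
  have hθ : Torus.IsSmoothSpaceTimeOn (Icc a b) θ := isSmoothSpaceTimeOn_coordFun_one hh hper
  have hf : Torus.IsSmoothSpaceTimeOn (Icc a b) f :=
    isSmoothSpaceTimeOn_coordFun_one (h := fun s y => r s * V y) (contDiffOn_uncurry_mul_sep hr hV _)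
      (fun s _ y => by simp only [hVper y])
  have heq : ∀ s ∈ Icc a b, ∀ z, Torus.timeDerivWithin (Icc a b) θ s z =
      ν * Torus.laplacian (θ s) z + f s z := by
    intro s hs z
    show derivWithin (fun τ => h τ (Torus.repr z 0)) (Icc a b) s = _
    rw [heat s hs, laplacian_coordFun_one (contDiff_slice_of_contDiffOn_uncurry hh hs) (hper s hs)]
  have ha : a ∈ Icc a b := left_mem_Icc.2 hab.le
  have H := exp_mul_mFourierCoeff_heatForced_eq hab hf hθ heq (Pi.single 0 m) ht
  rw [freqNormSq_single_zero] at H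
  -- read the torus coefficients as circle coefficients
  have hct : Continuous (h t) := (contDiff_slice_of_contDiffOn_uncurry hh ht).continuous
  have hca : Continuous (h a) := (contDiff_slice_of_contDiffOn_uncurry hh ha).continuous
  have e1 : mFourierCoeff (fun z => (θ t z : ℂ)) (Pi.single 0 m) =
      fourierCoeff (AddCircle.liftIco 1 0 fun y => (h t y : ℂ)) m := mFourierCoeff_coordFun_one hct (hper t ht) m
  have e2 : mFourierCoeff (fun z => (θ a z : ℂ)) (Pi.single 0 m) =
      fourierCoeff (AddCircle.liftIco 1 0 fun y => (h a y : ℂ)) m := mFourierCoeff_coordFun_one hca (hper a ha) m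
  have e3 : ∀ s, mFourierCoeff (fun z => (f s z : ℂ)) (Pi.single 0 m) =
      (r s : ℂ) * fourierCoeff (AddCircle.liftIco 1 0 fun y => (V y : ℂ)) m := by
    intro s
    rw [← mFourierCoeff_coordFun_one hV.continuous hVper m,
      show (fun z : UnitAddTorus (Fin 1) => ((V (Torus.repr z 0) : ℝ) : ℂ)) =
        fun z => ((V (Torus.repr z 0) : ℝ) : ℂ) from rfl, ← smul_eq_mul,
      ← Torus.mFourierCoeff_const_smul]
    congr 1
    funext z
    simp only [hf_def, Pi.smul_apply, smul_eq_mul, Complex.ofReal_mul]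
  rw [e1, e2] at H
  simp_rw [e3] at H
  rw [H, ← intervalIntegral.integral_ofReal, ← intervalIntegral.integral_mul_const]
  refine intervalIntegral.integral_congr fun s _ => ?_
  push_cast
  ring


/-- The coefficients of the zero profile vanish. -/
theorem fourierCoeff_liftIco_zero (m : ℤ) :
    fourierCoeff (AddCircle.liftIco 1 0 fun _ : ℝ => ((0 : ℝ) : ℂ)) m = 0 := by
  rw [fourierCoeff_liftIco_ofReal continuous_const m]
  simp

/-- **Forced heat profile from zero datum: coefficient bound.** Under the hypotheses of
`fourierCoeff_heatProfile_forced` with `ν ≥ 0` and `h(a, ·) = 0`: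
`‖𝓕(h(t))(m)‖ ≤ (∫ₐᵗ |r(s)| ds) · ‖𝓕(V)(m)‖` (the multiplier `e^{−λ(t−s)} ≤ 1`). -/
theorem norm_fourierCoeff_heatProfile_forced_le {a b ν : ℝ} (hab : a < b) (hν : 0 ≤ ν) {h : ℝ → ℝ → ℝ}
    (hh : ContDiffOn ℝ ∞ (Function.uncurry h) (Icc a b ×ˢ univ))
    (hper : ∀ t ∈ Icc a b, Function.Periodic (h t) 1)
    {r V : ℝ → ℝ} (hr : ContDiff ℝ ∞ r) (hV : ContDiff ℝ ∞ V) (hVper : Function.Periodic V 1)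
    (heat : ∀ t ∈ Icc a b, ∀ y,
      derivWithin (fun τ => h τ y) (Icc a b) t = ν * deriv (deriv (h t)) y + r t * V y)
    (h0 : h a = fun _ => 0) (m : ℤ) {t : ℝ} (ht : t ∈ Icc a b) :
    ‖fourierCoeff (AddCircle.liftIco 1 0 fun y => (h t y : ℂ)) m‖ ≤
      (∫ s in a..t, |r s|) * ‖fourierCoeff (AddCircle.liftIco 1 0 fun y => (V y : ℂ)) m‖ := by
  set lam : ℝ := 4 * Real.pi ^ 2 * ν * (m : ℝ) ^ 2 with hlam
  have hlam0 : 0 ≤ lam := by rw [hlam]; positivity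
  have hta : a ≤ t := ht.1
  have H := fourierCoeff_heatProfile_forced hab hh hper hr hV hVper heat m ht
  have hz : fourierCoeff (AddCircle.liftIco 1 0 fun y => (h a y : ℂ)) m = 0 := by
    rw [h0]; exact fourierCoeff_liftIco_zero m
  rw [hz, sub_zero] at H
  -- solve for the coefficient
  have hE : (0 : ℝ) < Real.exp (lam * (t - a)) := Real.exp_pos _
  have hcoef : fourierCoeff (AddCircle.liftIco 1 0 fun y => (h t y : ℂ)) m =
      ((Real.exp (-(lam * (t - a))) * ∫ s in a..t, Real.exp (lam * (s - a)) * r s : ℝ) : ℂ) *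
        fourierCoeff (AddCircle.liftIco 1 0 fun y => (V y : ℂ)) m := by
    have hEc : ((Real.exp (lam * (t - a)) : ℝ) : ℂ) ≠ 0 := by exact_mod_cast hE.ne'
    have := congrArg (fun z => ((Real.exp (-(lam * (t - a))) : ℝ) : ℂ) * z) H
    rw [← mul_assoc, ← Complex.ofReal_mul, Real.exp_neg, inv_mul_cancel₀ hE.ne', Complex.ofReal_one,
      one_mul] at this
    rw [this, Real.exp_neg]
    push_cast
    ring
  rw [hcoef, norm_mul, Complex.norm_real, Real.norm_eq_abs]
  refine mul_le_mul_of_nonneg_right ?_ (norm_nonneg _)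
  -- `|e^{-λ(t-a)} ∫ e^{λ(s-a)} r| ≤ ∫ |r|`
  rw [← intervalIntegral.integral_const_mul]
  have hcont : Continuous fun s => Real.exp (lam * (s - a)) * r s :=
    (Real.continuous_exp.comp (continuous_const.mul (continuous_id.sub continuous_const))).mul hr.continuous
  calc |∫ s in a..t, Real.exp (-(lam * (t - a))) * (Real.exp (lam * (s - a)) * r s)|
      ≤ ∫ s in a..t, |Real.exp (-(lam * (t - a))) * (Real.exp (lam * (s - a)) * r s)| :=
        intervalIntegral.abs_integral_le_integral_abs hta
    _ ≤ ∫ s in a..t, |r s| := by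
        refine intervalIntegral.integral_mono_on hta ?_ ?_ fun s hs => ?_
        · exact ((continuous_const.mul hcont).abs).intervalIntegrable _ _
        · exact hr.continuous.abs.intervalIntegrable _ _
        · rw [abs_mul, abs_mul, abs_of_pos (Real.exp_pos _), abs_of_pos (Real.exp_pos _), ← mul_assoc,
            ← Real.exp_add]
          have hle : Real.exp (-(lam * (t - a)) + lam * (s - a)) ≤ 1 := by
            rw [Real.exp_le_one_iff]
            nlinarith [hs.2, hlam0]
          exact mul_le_of_le_one_left (abs_nonneg _) hle

/-- **Homogeneous heat profile: the multiplier.** If `∂ₜ|_{[a,b]} h = ν ∂²_y h` (jointly smooth,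
`1`-periodic, `a < b`), then `𝓕(h(t))(m) = e^{−4π²νm²(t−a)} 𝓕(h(a))(m)` (tree
`Torus.mFourierCoeff_heat_eq_exp_mul` read on the coordinate function). -/
theorem fourierCoeff_heatProfile_eq_exp_mul {a b ν : ℝ} (hab : a < b) {h : ℝ → ℝ → ℝ}
    (hh : ContDiffOn ℝ ∞ (Function.uncurry h) (Icc a b ×ˢ univ))
    (hper : ∀ t ∈ Icc a b, Function.Periodic (h t) 1)
    (heat : ∀ t ∈ Icc a b, ∀ y, derivWithin (fun τ => h τ y) (Icc a b) t = ν * deriv (deriv (h t)) y)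
    (m : ℤ) {t : ℝ} (ht : t ∈ Icc a b) :
    fourierCoeff (AddCircle.liftIco 1 0 fun y => (h t y : ℂ)) m =
      ((Real.exp (-(4 * Real.pi ^ 2 * ν * (m : ℝ) ^ 2) * (t - a)) : ℝ) : ℂ) *
        fourierCoeff (AddCircle.liftIco 1 0 fun y => (h a y : ℂ)) m := by
  set θ : ℝ → UnitAddTorus (Fin 1) → ℝ := fun s z => h s (Torus.repr z 0) with hθ_def
  have hθ : Torus.IsSmoothSpaceTimeOn (Icc a b) θ := isSmoothSpaceTimeOn_coordFun_one hh hper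
  have heq : ∀ s ∈ Icc a b, ∀ z, Torus.timeDerivWithin (Icc a b) θ s z = ν * Torus.laplacian (θ s) z := by
    intro s hs z
    show derivWithin (fun τ => h τ (Torus.repr z 0)) (Icc a b) s = _
    rw [heat s hs, laplacian_coordFun_one (contDiff_slice_of_contDiffOn_uncurry hh hs) (hper s hs)]
  have ha : a ∈ Icc a b := left_mem_Icc.2 hab.le
  have H := Torus.mFourierCoeff_heat_eq_exp_mul hab hθ heq (Pi.single 0 m) ht
  rw [freqNormSq_single_zero,
    mFourierCoeff_coordFun_one (contDiff_slice_of_contDiffOn_uncurry hh ht).continuous (hper t ht) m,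
    mFourierCoeff_coordFun_one (contDiff_slice_of_contDiffOn_uncurry hh ha).continuous (hper a ha) m] at H
  exact H

/-! ## §3 Profile coefficient calculus: second derivatives, uniqueness, pointwise bounds -/

/-- A `1`-periodic function through `𝕋¹`: `G (repr (proj (y e₀)) 0) = G y`. -/
theorem coordFun_proj_single {F : Type*} {G : ℝ → F} (hG : Function.Periodic G 1) (y : ℝ) :
    G (Torus.repr (Torus.proj (y • EuclideanSpace.single (0 : Fin 1) (1 : ℝ))) 0) = G y := by
  have h := Torus.lift_coordFun_apply hG (0 : Fin 1) (y • EuclideanSpace.single (0 : Fin 1) (1 : ℝ))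
  rw [Torus.lift_apply] at h
  simpa using h

/-- **Second derivatives**: `𝓕(U'')(m) = −4π²m² 𝓕(U)(m)` for a smooth `1`-periodic profile. -/
theorem fourierCoeff_deriv_deriv {U : ℝ → ℝ} (hU : ContDiff ℝ ∞ U) (hper : Function.Periodic U 1) (m : ℤ) :
    fourierCoeff (AddCircle.liftIco 1 0 fun y => ((deriv (deriv U) y : ℝ) : ℂ)) m =
      -(((4 * Real.pi ^ 2 * (m : ℝ) ^ 2 : ℝ) : ℂ) * fourierCoeff (AddCircle.liftIco 1 0 fun y => (U y : ℂ)) m) := by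
  have hU2 : ContDiff ℝ ∞ (deriv (deriv U)) := by simpa using hU.iterate_deriv 2
  have hper2 : Function.Periodic (deriv (deriv U)) 1 := ShearCascade.periodic_deriv (ShearCascade.periodic_deriv hper)
  have hsm : Torus.IsSmooth (fun z : UnitAddTorus (Fin 1) => U (Torus.repr z 0)) := isSmooth_coordFun_one hU hper
  rw [← mFourierCoeff_coordFun_one hU2.continuous hper2 m, ← mFourierCoeff_coordFun_one hU.continuous hper m]
  have hlap : (fun z : UnitAddTorus (Fin 1) => ((deriv (deriv U) (Torus.repr z 0) : ℝ) : ℂ)) =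
      Torus.laplacian (fun z : UnitAddTorus (Fin 1) => ((U (Torus.repr z 0) : ℝ) : ℂ)) := by
    funext z
    rw [Torus.laplacian_ofReal hsm z, laplacian_coordFun_one hU hper z]
  rw [hlap, Torus.mFourierCoeff_laplacian (g := fun z : UnitAddTorus (Fin 1) => ((U (Torus.repr z 0) : ℝ) : ℂ))
    (hsm.comp_clm Complex.ofRealCLM), freqNormSq_single_zero, smul_eq_mul]

/-- **Uniqueness**: two smooth `1`-periodic real profiles with the same Fourier coefficients coincide. -/
theorem profile_eq_of_fourierCoeff_eq {g₁ g₂ : ℝ → ℝ} (hg₁ : ContDiff ℝ ∞ g₁) (hper₁ : Function.Periodic g₁ 1)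
    (hg₂ : ContDiff ℝ ∞ g₂) (hper₂ : Function.Periodic g₂ 1)
    (h : ∀ m : ℤ, fourierCoeff (AddCircle.liftIco 1 0 fun y => (g₁ y : ℂ)) m =
      fourierCoeff (AddCircle.liftIco 1 0 fun y => (g₂ y : ℂ)) m) :
    g₁ = g₂ := by
  have hs₁ : Torus.IsSmooth (fun z : UnitAddTorus (Fin 1) => ((g₁ (Torus.repr z 0) : ℝ) : ℂ)) :=
    (isSmooth_coordFun_one hg₁ hper₁).comp_clm Complex.ofRealCLM
  have hs₂ : Torus.IsSmooth (fun z : UnitAddTorus (Fin 1) => ((g₂ (Torus.repr z 0) : ℝ) : ℂ)) :=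
    (isSmooth_coordFun_one hg₂ hper₂).comp_clm Complex.ofRealCLM
  have heq := Torus.IsSmooth.ext_mFourierCoeff hs₁ hs₂ fun k => by
    rw [fin_one_freq_eq k, mFourierCoeff_coordFun_one hg₁.continuous hper₁,
      mFourierCoeff_coordFun_one hg₂.continuous hper₂, h]
  funext y
  have h1 := congrFun heq (Torus.proj (y • EuclideanSpace.single (0 : Fin 1) (1 : ℝ)))
  simp only at h1
  rw [coordFun_proj_single hper₁, coordFun_proj_single hper₂] at h1
  exact_mod_cast h1

/-- For a `1`-periodic `G`, the descended function `liftIco 1 0 G` agrees with `G` at every real point. -/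
theorem liftIco_coe_eq_of_periodic {F : Type*} {G : ℝ → F} (hper : Function.Periodic G 1) (y : ℝ) :
    AddCircle.liftIco 1 0 G (y : AddCircle (1 : ℝ)) = G y := by
  have hfr : Int.fract y ∈ Ico (0 : ℝ) (0 + 1) := by
    rw [zero_add]; exact ⟨Int.fract_nonneg y, Int.fract_lt_one y⟩
  have hcoe : ((y : ℝ) : AddCircle (1 : ℝ)) = ((Int.fract y : ℝ) : AddCircle (1 : ℝ)) := by
    rw [eq_comm, ← sub_eq_zero, ← AddCircle.coe_sub, AddCircle.coe_eq_zero_iff]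
    refine ⟨-⌊y⌋, ?_⟩
    rw [Int.fract]
    simp
  rw [hcoe, AddCircle.liftIco_coe_apply hfr, Int.fract]
  have := (hper.int_mul ⌊y⌋).sub_eq y
  rwa [mul_one] at this

/-- **Pointwise bound from the coefficients.** A continuous `1`-periodic `G : ℝ → ℂ` whose Fourier
coefficients are absolutely summable is bounded pointwise by the sum of their norms. -/
theorem norm_le_tsum_norm_fourierCoeff {G : ℝ → ℂ} (hG : Continuous G) (hper : Function.Periodic G 1)
    (hsum : Summable fun m : ℤ => ‖fourierCoeff (AddCircle.liftIco 1 0 G) m‖) (y : ℝ) :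
    ‖G y‖ ≤ ∑' m : ℤ, ‖fourierCoeff (AddCircle.liftIco 1 0 G) m‖ := by
  set F : C(AddCircle (1 : ℝ), ℂ) := ⟨AddCircle.liftIco 1 0 G, continuous_liftIco_of_periodic hG hper⟩ with hF
  have hsum' : Summable (fourierCoeff F) := hsum.of_norm
  have H := has_pointwise_sum_fourier_series_of_summable hsum' (y : AddCircle (1 : ℝ))
  have hFy : F (y : AddCircle (1 : ℝ)) = G y := liftIco_coe_eq_of_periodic hper y
  rw [hFy] at H
  rw [← H.tsum_eq]
  have hn1 : ∀ i : ℤ, ‖fourierCoeff F i • fourier i (y : AddCircle (1 : ℝ))‖ =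
      ‖fourierCoeff (AddCircle.liftIco 1 0 G) i‖ := by
    intro i
    rw [norm_smul, show ‖fourier i (y : AddCircle (1 : ℝ))‖ = 1 from Circle.norm_coe _, mul_one]
    rfl
  refine (norm_tsum_le_tsum_norm ?_).trans (le_of_eq (tsum_congr hn1))
  exact hsum.congr fun i => (hn1 i).symm

end Summit.AnomalousDissipation.AnomalousDissipation.Theorems.SawtoothPulseCascade.ApproxResponse

end
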